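import Literature.Barriers.HodgeConjecture.GeneralizedHodgeTrivialReasonsKernelSubHodge
import Literature.Barriers.HodgeConjecture.GeneralizedHodgeTrivialReasonsTorusSymmetryProofs
import Literature.AlgebraicGeometry.HodgeTheory.SupportedHodgeClassesAlgebraic
import Literature.AlgebraicGeometry.HodgeTheory.ThomGysinClosedImmersion
import Literature.AlgebraicGeometry.HodgeTheory.GysinKernelProofs
import Literature.AlgebraicGeometry.HodgeTheory.SupportedClassesRationalProofs
import Literature.AlgebraicGeometry.HodgeTheory.HodgeModelExistence
import HarnessLib

/-!
# Grothendieck (1969), p. 300, along the printed line: Gysin images of desingularisations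
# (Deligne) and "the previous homomorphisms are compatible with the Hodge structures" — the
# line PROVED, its two Hodge-theoretic inputs explicit

Companion to `GeneralizedHodgeTrivialReasonsSubHodge` (the named fact
`Grothendieck1969_supportedClasses_isSubHodge`: for `X` smooth projective over `ℂ`, every Hodge
model `A`, all `i, p`, the complex span of the rational classes of
`Nᵖ Hⁱ(X(ℂ); ℂ) = supportedClasses X i p`, Grothendieck's `Filt'ᵖ Hⁱ(X^an, ℚ) ⊗ ℂ`, pulled back to
`Hⁱ(X^an; ℂ)`, is a sub-Hodge structure) and to `GeneralizedHodgeTrivialReasonsKernelSubHodge`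
(the reduction of that fact, closed set by closed set, to clause (i) of Voisin 2014, Thm. 2.39 —
Deligne's theorem in its modern packaged form — taken as an explicit hypothesis `hK`).

Source read (A. Grothendieck, *Hodge's general conjecture is false for trivial reasons*,
Topology 8 (1969), p. 300, held copy `paper:doi-10-1016-0040-9383-69-90016-0`, p. 2), verbatim:
"Let us remark that the complex space `Filt'ᵖ Hⁱ(X^an, ℂ)` generated by the left hand side of (∗)
is a sub-Hodge structure of `Hⁱ(X^an, ℂ)`, i.e. is stable under the decomposition into types
`p, q`. This fact, which is probably "well-known", follows from the fact that `Filt'ᵖ` can be also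
described as the space generated by the images of the Gysin homomorphisms
`H^{i-2q}(Y^an, ℚ) → Hⁱ(X^an, ℚ)` for desingularizations `Y` of closed subschemes `T` of `X` which
are of pure codimension `q ≥ p`. I will skip the proof of this fact, already stated and used in
[5, 10.1]†. As the previous homomorphisms are compatible with the Hodge structures, the assertion
follows." — footnote † (added April 1969): "the statement in loc. cit. […] is false in the form
given there. It is true however for `X` proper, and constant coefficients `ℚ_ℓ` […] provided we
admit resolution of singularities and the Weil conjectures. Moreover in char. zero, the last
statement is true, as a consequence of P. Deligne's recent extension of Hodge theory to arbitrary
complex algebraic varieties (possibly singular and non-complete)."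

## What this file proves (everything below is a `theorem`; no definition, no named fact — D-0026)

This file formalises THAT printed line — the architecture of p. 300 itself rather than its
modern repackaging — on the tree's real carriers, and proves it, with exactly the inputs
Grothendieck names made explicit:

1. "desingularizations `Y` of closed subschemes `T` of `X` which are of pure codimension `q ≥ p`"
   — the tree's `exists_family_iUnion_range_eq_of_isClosed` (`HodgeTheory/SupportedHodgeClassesAlgebraic`,
   PROVED from the named fact `Resolution.Hironaka1964_projective`, Kollár 2007 Thm. 3.27): a
   Zariski-closed `Z ⊆ X` all of whose points have codimension `≥ r` is `⋃ⱼ gⱼ(Yⱼ)` for finitely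
   many morphisms `gⱼ : Yⱼ ⟶ X` from smooth projective `Yⱼ` of dimensions `mⱼ ≤ n - r`;
2. "`Filt'ᵖ` can be also described as the space generated by the images of the Gysin
   homomorphisms" / footnote † (Deligne) — the tree's named fact
   `Deligne1974_ker_restrictCompl_eq_iSup_range_complexGysin` (`HodgeTheory/GysinKernel`; Hodge III,
   Cor. 8.2.8: `ker (Hᵇ(X(ℂ)) → Hᵇ((X ∖ ⋃ⱼ gⱼ(Yⱼ))(ℂ))) = Σⱼ im (gⱼ)_*` for the REAL Gysin morphisms
   `complexGysin μ` of `HodgeTheory/ComplexGysin`, relative to an orientation family `μ`; its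
   hypothesis "Poincaré duality for `μ`" is the tree's theorem `OrientationFamily.hasPoincareDuality`);
3. "the previous homomorphisms are compatible with the Hodge structures" — the Gysin morphism
   `g_* : Hᵃ(Y(ℂ)) → Hᵇ(X(ℂ))` of a morphism `g : Y ⟶ X` of smooth projective varieties,
   `dim X = dim Y + c`, is a morphism of Hodge structures of bidegree `(c, c)` (Voisin I, §7.3.2:
   "It is easy to see that `φ_*` is a morphism of Hodge structures of bidegree `(r, r)`"). The tree
   records this property only as the field `isOfHodgeType_gysin` of the hypothesis predicate
   `GysinFormalism.IsHodgeCompatible` on an ABSTRACT Gysin formalism (`HodgeTheory/GysinFormalismHodge`,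
   "consumers take `(G : GysinFormalism) (hG : G.IsHodgeCompatible)` as explicit hypotheses"); here
   it is needed for the real `complexGysin μ` and enters, in the very same additive shape
   (type `(p, q)` ↦ type `(p', q')`, `p' + dim Y = p + dim X`, `q' + dim Y = q + dim X`), as the
   EXPLICIT HYPOTHESIS `hG` of the theorems below — deliberately NOT vendored as a named fact
   (D-0026; its discharge is classical Hodge theory: `g_*` on de Rham classes is the push-forward of
   currents, which preserves the type, Voisin I §7.3.2, for the complex orientation; for another
   `μ` the maps `complexGysin μ` differ from these by a unit on each `Yⱼ(ℂ)`, `X(ℂ)` connected, so the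
   property does not depend on `μ`);
4. "the Hodge structures" of `H˙(Y^an)` — Hodge models of the `Yⱼ` (named fact
   `nonempty_hodgeModel`, `HodgeTheory/HodgeModelExistence`) — and THE Hodge decomposition of
   `H˙(X^an)` in which the conclusion is read (named fact `hodgePQ_independent_of_hodgeModel`,
   `HodgeTheory/HodgeFiltrationModels`, because the target quantifies over every Hodge model `A` of
   `X` while `IsOfHodgeType` quantifies `∃` over models).

With these, "the assertion follows" is PROVED here, and slightly more — the same Gysin description
also yields Grothendieck's inclusion (∗) `Filt'ᵖ ⊂ Filtᵖ` of p. 299 ("it is well-known that the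
second is finer than the first"), in the sharper coniveau form of Voisin 2014, Thm. 2.39 (ii):

* `HodgeModel.eq_top_of_forall_mem_hodgePQ` — decomposition of an arbitrary class of `Hᵃ(Y(ℂ); ℂ)`
  along the Hodge decomposition of a model of `Y` (a subspace containing all classes of pure type
  is everything);
* `map_range_complexGysin_le_iSup_inf_hodgePQ`, `HodgeModel.IsSubHodge.map_range_complexGysin`,
  `map_range_complexGysin_le_hodgeConiveau` — **the image of a Gysin morphism of bidegree `(c, c)`
  is a sub-Hodge structure of Hodge coniveau `≥ c`** (the image of a morphism of Hodge structures
  is a sub-Hodge structure, Voisin I §7.3.1 (7.5); here from `hG` for that one morphism);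
* `isSubHodge_map_ker_restrictCompl_of_isClosedImmersion` — the case of a SMOOTH closed `T = Y`
  WITHOUT Deligne and without resolution: the kernel of `Hᵏ(X(ℂ)) → Hᵏ((X ∖ Y)(ℂ))` is the Gysin
  image unconditionally (Thom–Gysin, the tree's
  `ker_restrictCompl_eq_iSup_range_complexGysin_of_isClosedImmersion`), hence a sub-Hodge structure of
  coniveau `≥ codim Y` given only `hG` for the immersion, a Hodge model of `Y` and
  `hodgePQ_independent_of_hodgeModel`;
* `isSubHodge_map_ker_restrictCompl_of_gysin` — for every Zariski-closed `Z` of codimension `≥ r`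
  pointwise: the kernel of `Hᵏ(X(ℂ); ℂ) → Hᵏ((X ∖ Z)(ℂ); ℂ)` pulled back to any Hodge model `A` is a
  sub-Hodge structure (clause (i)) of Hodge coniveau `≥ r` (clause (ii)), from 1–4;
* the cluster's named facts along this line, from the named facts `hD` (Deligne), `hH` (Hironaka),
  `hM` (Hodge models), `hI` (independence of the model) and the hypothesis `hG`:
  `Grothendieck1969_supportedClasses_isSubHodge_of_gysin` (THE TARGET of this cluster's prove-seat),
  `Grothendieck1969_supportedClasses_le_hodgeConiveau_of_gysin`,
  `Grothendieck1969_supportedClasses_le_hodgeFiltration_of_gysin` ((∗) of p. 299),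
  `Grothendieck1969_rationalSupportedClasses_evenRank_of_gysin` (with a real Hodge model), and the
  barrier itself `Grothendieck1969_generalHodgeConjecture_false_of_gysin` (with the Hodge structure
  of `H³(E_τ³)`, `Grothendieck1969_ellipticCurveCubed_hodgeDecomposition`); universal coefficients
  for `X(ℂ)` enter through the tree's DISCHARGED `span_isRationalClass_eq_top_of_isSmoothProjective_holds`.

Relative to `…KernelSubHodge` (hypothesis `hK` = Thm. 2.39 (i) wholesale, i.e. Deligne's theorem
with the Gysin compatibility folded in), the residual Hodge-theoretic trust of the target is split
here exactly as on p. 300: the MIXED Hodge theory is confined to the named fact of item 2 (whose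
inclusion `⊇` and whose reduction to its homological core are proved in `GysinKernelProofs`), and
what is asked of PURE Hodge theory is item 3 alone.

Not here: the discharge of items 2–4 (Deligne's Hodge II–III; Hironaka; GAGA + Hodge
decomposition; Thom rigidity) or of `hG` (push-forward of currents / Poincaré duality compatible
with the Hodge decomposition) — none in Mathlib or the tree.

## References

* [GrothendieckTopology1969] A. Grothendieck, Hodge's general conjecture is false for trivial
  reasons, Topology 8 (1969) 299–303, p. 299 (∗), p. 300 and footnote †.
* [DeligneHodgeIII1974] P. Deligne, Théorie de Hodge III, Publ. Math. IHÉS 44 (1974), Prop. 8.2.7,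
  Cor. 8.2.8.
* [VoisinHodgeI2002] C. Voisin, Hodge Theory and Complex Algebraic Geometry I, CUP 2002, §7.3.1
  ((7.5): the image of a morphism of Hodge structures), §7.3.2 (Gysin morphism of bidegree
  `(r, r)`), §6.1.3 (Hodge decomposition).
* [VoisinChowRings2014] C. Voisin, Chow Rings, Decomposition of the Diagonal, and the Topology of
  Families, Ann. of Math. Stud. 187 (2014), Def. 2.38, Thm. 2.39 and its proof.
* [Kollar2007] J. Kollár, Lectures on Resolution of Singularities, Ann. of Math. Stud. 166 (2007),
  Thm. 3.27.
-/

noncomputable section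

open CategoryTheory AlgebraicGeometry

namespace Literature.Barriers.HodgeConjecture

section Barriers
section HodgeConjecture

open Literature.AlgebraicGeometry.HodgeTheory Literature.AlgebraicGeometry.Motives
  Literature.AlgebraicTopology.SingularHomology
open Literature.AlgebraicGeometry.Resolution (Hironaka1964_projective)

/-! ### Decomposing a class along the Hodge decomposition of a model -/

section Decompose

variable {m : ℕ} {Y : SchemeOver ℂ}

/-- **Decomposition into types.** A `ℂ`-subspace `S ⊆ Hᵃ(Y(ℂ); ℂ)` which contains every class
whose pull-back to a Hodge model `B` of `Y` is of pure type `(r, s)`, `r + s = a`, is all of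
`Hᵃ(Y(ℂ); ℂ)`: the pull-back `Hᵃ(Y(ℂ); ℂ) → Hᵃ(Y^an; ℂ)` is bijective and
`Hᵃ(Y^an; ℂ) = ⨁_{r+s=a} H^{r,s}` (Hodge decomposition of the model, `HodgeModel.isSubHodge_top`).
[cite: VoisinHodgeI2002, §6.1.3 and §7.1.1] -/
theorem _root_.Literature.AlgebraicGeometry.HodgeTheory.HodgeModel.eq_top_of_forall_mem_hodgePQ
    (B : HodgeModel m Y) (a : ℕ) {S : Submodule ℂ (complexBetti Y a)}
    (hS : ∀ (r s : ℕ), r + s = a → ∀ y : complexBetti Y a,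
      B.pullback a y ∈ B.hodgePQ a r s → y ∈ S) :
    S = ⊤ := by
  refine eq_top_iff.2 fun y _ ↦ ?_
  -- the Hodge decomposition of `B`
  have htop : (⊤ : Submodule ℂ (singularCohomology ℂ ℂ B.carrier a)) =
      ⨆ (r : ℕ) (s : ℕ) (_ : r + s = a), ⊤ ⊓ B.hodgePQ a r s := B.isSubHodge_top a
  have hy : B.pullback a y ∈ ⨆ (r : ℕ) (s : ℕ) (_ : r + s = a), ⊤ ⊓ B.hodgePQ a r s := by
    rw [← htop]; exact Submodule.mem_top
  -- each piece is reached from `S`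
  have hle : (⨆ (r : ℕ) (s : ℕ) (_ : r + s = a), ⊤ ⊓ B.hodgePQ a r s) ≤
      S.map (B.pullback a).hom := by
    refine iSup_le fun r ↦ iSup_le fun s ↦ iSup_le fun hrs ↦ ?_
    rintro x ⟨-, hx⟩
    obtain ⟨y', rfl⟩ := B.pullback_surjective a x
    exact ⟨y', hS r s hrs y' hx, rfl⟩
  obtain ⟨y', hy', hyy'⟩ := hle hy
  obtain rfl : y' = y := B.pullback_injective a hyy'
  exact hy'

end Decompose

/-! ### The image of a Gysin morphism of bidegree `(c, c)` is a sub-Hodge structure of coniveau `≥ c` -/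

section GysinImage

variable {m n : ℕ} {Y X : SchemeOver ℂ}

/-- **Core of "the assertion follows", one Gysin morphism at a time.** Let `g : Y ⟶ X` be a
morphism of smooth projective varieties, `g_* = complexGysin μ … : Hᵃ(Y(ℂ); ℂ) → Hᵇ(X(ℂ); ℂ)` its
Gysin morphism in degrees `a + 2 dim X = b + 2 dim Y`, `B` a Hodge model of `Y`, `A` one of `X`,
and assume `g_*` maps classes of type `(r, s)` to classes of type `(r + c, s + c)` (hypothesis
`hg`: "the previous homomorphisms are compatible with the Hodge structures"). Then the image
`W := im g_*`, pulled back to `Hᵇ(X^an; ℂ)`, satisfies `W ⊆ Σ_{r+s=a} W ∩ H^{r+c, s+c}`: decompose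
`y = Σ y^{r,s}` in `B` (`HodgeModel.eq_top_of_forall_mem_hodgePQ`); each `g_* y^{r,s}` lies in `W`
and is of type `(r+c, s+c)`, read in `A` by `hodgePQ_independent_of_hodgeModel` (`hI`).
[cite: GrothendieckTopology1969, p. 300] [cite: VoisinHodgeI2002, §7.3.1 (7.5) and §7.3.2] -/
theorem map_range_complexGysin_le_iSup_inf_hodgePQ (hI : hodgePQ_independent_of_hodgeModel)
    (μ : OrientationFamily) (hY : IsSmoothProjective m Y) (hX : IsSmoothProjective n X)
    (B : HodgeModel m Y) (A : HodgeModel n X) (g : Y ⟶ X) {a b : ℕ}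
    (hab : a + 2 * n = b + 2 * m) {c : ℕ}
    (hg : ∀ ⦃r s : ℕ⦄ ⦃y : complexBetti Y a⦄, IsOfHodgeType m Y a r s y →
      IsOfHodgeType n X b (r + c) (s + c) (complexGysin μ hY hX g hab y)) :
    (LinearMap.range (complexGysin μ hY hX g hab)).map (A.pullback b).hom ≤
      ⨆ (r : ℕ) (s : ℕ) (_ : r + s = a),
        (LinearMap.range (complexGysin μ hY hX g hab)).map (A.pullback b).hom ⊓
          A.hodgePQ b (r + c) (s + c) := by
  set W := (LinearMap.range (complexGysin μ hY hX g hab)).map (A.pullback b).hom with hW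
  -- the classes of `Y` whose Gysin image, pulled back to `A`, decomposes inside `W`
  let S : Submodule ℂ (complexBetti Y a) :=
    (⨆ (r : ℕ) (s : ℕ) (_ : r + s = a), W ⊓ A.hodgePQ b (r + c) (s + c)).comap
      ((A.pullback b).hom ∘ₗ complexGysin μ hY hX g hab)
  have hS : S = ⊤ := by
    refine B.eq_top_of_forall_mem_hodgePQ a fun r s hrs y hy ↦ ?_
    have htyp : IsOfHodgeType n X b (r + c) (s + c) (complexGysin μ hY hX g hab y) := hg ⟨B, hy⟩
    have hmem : A.pullback b (complexGysin μ hY hX g hab y) ∈ W ⊓ A.hodgePQ b (r + c) (s + c) :=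
      ⟨Submodule.mem_map_of_mem (LinearMap.mem_range_self _ y), (hI.isOfHodgeType_iff hX A).1 htyp⟩
    exact Submodule.mem_comap.2 (Submodule.mem_iSup_of_mem r (Submodule.mem_iSup_of_mem s
      (Submodule.mem_iSup_of_mem hrs hmem)))
  rintro _ ⟨_, ⟨y, rfl⟩, rfl⟩
  have hy : y ∈ S := by rw [hS]; exact Submodule.mem_top
  exact Submodule.mem_comap.1 hy

/-- **The image of a Gysin morphism of bidegree `(c, c)`, `dim X = dim Y + c`, is a sub-Hodge
structure** of `Hᵇ(X^an; ℂ)` (in every Hodge model `A` of `X`): `W ⊆ Σ_{r+s=a} W ∩ H^{r+c,s+c}`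
and `(r + c) + (s + c) = b`. Grothendieck: "As the previous homomorphisms are compatible with the
Hodge structures, the assertion follows"; Voisin I (7.5): the image of a morphism of Hodge
structures is a sub-Hodge structure. Dot-notation extension of `HodgeModel.IsSubHodge`
(`GeneralizedHodgeTrivialReasonsSubHodge`), declared from the barrier catalogue like the
predicate. [cite: GrothendieckTopology1969, p. 300] [cite: VoisinHodgeI2002, §7.3.1 (7.5) and §7.3.2] -/
theorem _root_.Literature.AlgebraicGeometry.HodgeTheory.HodgeModel.IsSubHodge.map_range_complexGysin
    (hI : hodgePQ_independent_of_hodgeModel) (μ : OrientationFamily) (hY : IsSmoothProjective m Y)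
    (hX : IsSmoothProjective n X) (B : HodgeModel m Y) (A : HodgeModel n X) (g : Y ⟶ X)
    {a b : ℕ} (hab : a + 2 * n = b + 2 * m) {c : ℕ} (hc : m + c = n)
    (hg : ∀ ⦃r s : ℕ⦄ ⦃y : complexBetti Y a⦄, IsOfHodgeType m Y a r s y →
      IsOfHodgeType n X b (r + c) (s + c) (complexGysin μ hY hX g hab y)) :
    A.IsSubHodge b ((LinearMap.range (complexGysin μ hY hX g hab)).map (A.pullback b).hom) := by
  refine (A.isSubHodge_iff_le b _).2
    ((map_range_complexGysin_le_iSup_inf_hodgePQ hI μ hY hX B A g hab hg).trans ?_)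
  refine iSup_le fun r ↦ iSup_le fun s ↦ iSup_le fun hrs ↦ ?_
  exact le_iSup_of_le (r + c) (le_iSup_of_le (s + c) (le_iSup_of_le (by omega) le_rfl))

/-- **… and it has Hodge coniveau `≥ c`**: `im g_* ⊆ ⨆_{p, q ≥ c, p+q=b} H^{p,q}`
(`HodgeModel.hodgeConiveau A b c`), since `r + c ≥ c`, `s + c ≥ c` — the Gysin image of
`H^{i-2q}(Y^an)` "lands in `Filt^q`", the mechanism behind the inclusion (∗) of p. 299; Voisin
2014, Def. 2.38 / Thm. 2.39 (ii) ("of coniveau `≥ c`").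
[cite: GrothendieckTopology1969, p. 299 (∗) and p. 300] [cite: VoisinChowRings2014, Def. 2.38 and Thm. 2.39] -/
theorem map_range_complexGysin_le_hodgeConiveau (hI : hodgePQ_independent_of_hodgeModel)
    (μ : OrientationFamily) (hY : IsSmoothProjective m Y) (hX : IsSmoothProjective n X)
    (B : HodgeModel m Y) (A : HodgeModel n X) (g : Y ⟶ X) {a b : ℕ}
    (hab : a + 2 * n = b + 2 * m) {c : ℕ} (hc : m + c = n)
    (hg : ∀ ⦃r s : ℕ⦄ ⦃y : complexBetti Y a⦄, IsOfHodgeType m Y a r s y →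
      IsOfHodgeType n X b (r + c) (s + c) (complexGysin μ hY hX g hab y)) :
    (LinearMap.range (complexGysin μ hY hX g hab)).map (A.pullback b).hom ≤
      A.hodgeConiveau b c := by
  refine (map_range_complexGysin_le_iSup_inf_hodgePQ hI μ hY hX B A g hab hg).trans ?_
  refine iSup_le fun r ↦ iSup_le fun s ↦ iSup_le fun hrs ↦ inf_le_right.trans ?_
  exact A.hodgePQ_le_hodgeConiveau (by omega) (Nat.le_add_left c r) (Nat.le_add_left c s)

end GysinImage

/-! ### The kernel of restriction to a Zariski-open complement, closed set by closed set -/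

section Kernel

variable {n : ℕ} {X : SchemeOver ℂ}

/-- **The case of a SMOOTH closed `T = Y ⊆ X` needs neither Deligne nor resolution.** For a
closed immersion `i : Y ⟶ X` of smooth projective varieties, `dim X = dim Y + c`, the kernel of
`Hᵏ(X(ℂ); ℂ) → Hᵏ((X ∖ Y)(ℂ); ℂ)` IS the Gysin image `im i_*` unconditionally (Thom–Gysin exact
sequence; the tree's `ker_restrictCompl_eq_iSup_range_complexGysin_of_isClosedImmersion`,
`HodgeTheory/ThomGysinClosedImmersion`), so — given a Hodge model `B` of `Y`, the independence of
the model on `X` (`hI`) and the bidegree `(c, c)` of `i_*` (`hi`) — its pull-back to any Hodge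
model `A` of `X` is a sub-Hodge structure of Hodge coniveau `≥ c`.
[cite: GrothendieckTopology1969, p. 300] [cite: VoisinHodgeI2002, §7.3.2] -/
theorem isSubHodge_map_ker_restrictCompl_of_isClosedImmersion
    (hI : hodgePQ_independent_of_hodgeModel) (μ : OrientationFamily) (hX : IsSmoothProjective n X)
    {m : ℕ} {Y : SchemeOver ℂ} (hY : IsSmoothProjective m Y) (i : Y ⟶ X)
    [IsClosedImmersion i.left] (B : HodgeModel m Y) (A : HodgeModel n X) (k : ℕ) {c : ℕ}
    (hc : m + c = n)
    (hi : ∀ ⦃a : ℕ⦄ (hab : a + 2 * n = k + 2 * m) ⦃r s : ℕ⦄ ⦃y : complexBetti Y a⦄,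
      IsOfHodgeType m Y a r s y →
        IsOfHodgeType n X k (r + c) (s + c) (complexGysin μ hY hX i hab y)) :
    A.IsSubHodge k ((LinearMap.ker
        (complexBetti.restrictCompl X (Set.range i.left.base) k).hom).map (A.pullback k).hom) ∧
      (LinearMap.ker (complexBetti.restrictCompl X (Set.range i.left.base) k).hom).map
          (A.pullback k).hom ≤ A.hodgeConiveau k c := by
  rw [ker_restrictCompl_eq_iSup_range_complexGysin_of_isClosedImmersion μ hX hY i k]
  simp only [Submodule.map_iSup]
  exact ⟨HodgeModel.IsSubHodge.iSup A fun a ↦ HodgeModel.IsSubHodge.iSup A fun hab ↦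
      HodgeModel.IsSubHodge.map_range_complexGysin hI μ hY hX B A i hab hc (hi hab),
    iSup_le fun a ↦ iSup_le fun hab ↦
      map_range_complexGysin_le_hodgeConiveau hI μ hY hX B A i hab hc (hi hab)⟩

/-- **Grothendieck's line for one closed `T`: the kernel of `Hᵏ(X(ℂ); ℂ) → Hᵏ((X ∖ T)(ℂ); ℂ)` is a
sub-Hodge structure of Hodge coniveau `≥ codim T`.** Let `X` be smooth projective of dimension `n`,
`A` a Hodge model, `Z ⊆ X` Zariski-closed with all points of codimension `≥ r`. Write
`Z = ⋃ⱼ gⱼ(Yⱼ)` with `gⱼ : Yⱼ ⟶ X` from smooth projective `Yⱼ` of dimensions `mⱼ ≤ n - r`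
(resolutions of the components; `exists_family_iUnion_range_eq_of_isClosed`, Hironaka `hH`); by
Deligne (`hD`, with `OrientationFamily.hasPoincareDuality`) the kernel is `Σⱼ im (gⱼ)_*`; each
`im (gⱼ)_*` is a sub-Hodge structure of coniveau `≥ n - mⱼ ≥ r` (Hodge models of the `Yⱼ` from
`hM`, bidegree of `(gⱼ)_*` from `hG`, read in `A` by `hI`), and sums of such are such
(`HodgeModel.IsSubHodge.iSup`, `HodgeModel.hodgeConiveau_mono`). Clauses (i) and (ii) of Voisin
2014, Thm. 2.39, obtained along the route of its printed proof.
[cite: GrothendieckTopology1969, p. 300 and footnote †] [cite: DeligneHodgeIII1974, Cor. 8.2.8]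
[cite: VoisinChowRings2014, Thm. 2.39 (proof)] [cite: Kollar2007, Thm. 3.27] -/
theorem isSubHodge_map_ker_restrictCompl_of_gysin
    (hD : Deligne1974_ker_restrictCompl_eq_iSup_range_complexGysin)
    (hH : Hironaka1964_projective.{0})
    (hM : ∀ (m : ℕ) (Y : SchemeOver ℂ), nonempty_hodgeModel m Y)
    (hI : hodgePQ_independent_of_hodgeModel) (μ : OrientationFamily)
    (hG : ∀ ⦃m n : ℕ⦄ ⦃Y X : SchemeOver ℂ⦄ (hY : IsSmoothProjective m Y)
      (hX : IsSmoothProjective n X) (g : Y ⟶ X) ⦃a b : ℕ⦄ (hab : a + 2 * n = b + 2 * m)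
      ⦃p q p' q' : ℕ⦄, p' + m = p + n → q' + m = q + n → ∀ ⦃y : complexBetti Y a⦄,
        IsOfHodgeType m Y a p q y → IsOfHodgeType n X b p' q' (complexGysin μ hY hX g hab y))
    (hX : IsSmoothProjective n X) (A : HodgeModel n X) (k : ℕ) {Z : Set X.left} (hZ : IsClosed Z)
    {r : ℕ} (hr : ∀ z ∈ Z, (r : ℕ∞) ≤ Order.coheight z) :
    A.IsSubHodge k ((LinearMap.ker (complexBetti.restrictCompl X Z k).hom).map (A.pullback k).hom) ∧
      (LinearMap.ker (complexBetti.restrictCompl X Z k).hom).map (A.pullback k).hom ≤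
        A.hodgeConiveau k r := by
  -- `Z = ⋃ⱼ gⱼ(Yⱼ)`, `Yⱼ` smooth projective of dimension `mⱼ ≤ n - r`
  obtain ⟨ι, _, m, Y, hY, g, hZeq, hm⟩ := exists_family_iUnion_range_eq_of_isClosed hH hX hZ hr
  -- Deligne: the kernel is the sum of the Gysin images
  rw [Deligne1974_ker_restrictCompl_eq_iSup_range_complexGysin.ker_restrictCompl_eq_of_iUnion_range_eq
    hD μ μ.hasPoincareDuality hX hY g hZeq k]
  simp only [Submodule.map_iSup]
  -- Hodge models of the `Yⱼ`, and the bidegree `(n - mⱼ, n - mⱼ)` of `(gⱼ)_*`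
  have hB : ∀ j, Nonempty (HodgeModel (m j) (Y j)) := fun j ↦ hM (m j) (Y j) (hY j)
  have hg : ∀ (j : ι) (a : ℕ) (hab : a + 2 * n = k + 2 * m j) ⦃p q : ℕ⦄ ⦃y : complexBetti (Y j) a⦄,
      IsOfHodgeType (m j) (Y j) a p q y →
        IsOfHodgeType n X k (p + (n - m j)) (q + (n - m j)) (complexGysin μ (hY j) hX (g j) hab y) :=
    fun j a hab p q y hy ↦
      hG (hY j) hX (g j) hab (by have := hm j; omega) (by have := hm j; omega) hy
  refine ⟨?_, iSup_le fun j ↦ iSup_le fun a ↦ iSup_le fun hab ↦ ?_⟩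
  · exact HodgeModel.IsSubHodge.iSup A fun j ↦ HodgeModel.IsSubHodge.iSup A fun a ↦
      HodgeModel.IsSubHodge.iSup A fun hab ↦
        HodgeModel.IsSubHodge.map_range_complexGysin hI μ (hY j) hX (hB j).some A (g j) hab
          (c := n - m j) (by have := hm j; omega) (hg j a hab)
  · exact (map_range_complexGysin_le_hodgeConiveau hI μ (hY j) hX (hB j).some A (g j) hab
      (c := n - m j) (by have := hm j; omega) (hg j a hab)).trans
        (A.hodgeConiveau_mono k (by have := hm j; omega))

/-- The complexified rational kernel of `…KernelSubHodge` IS the kernel, unconditionally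
(universal coefficients for `X(ℂ)`, the tree's DISCHARGED
`span_isRationalClass_eq_top_of_isSmoothProjective_holds`, through `ker_restrictCompl_le_span`):
`span_ℂ {x rational | x|_{(X ∖ Z)(ℂ)} = 0} = ker (Hᵏ(X(ℂ); ℂ) → Hᵏ((X ∖ Z)(ℂ); ℂ))`,
"`(Ker j*) ⊗ ℂ = Ker (j* ⊗ ℂ)`". [cite: GrothendieckTopology1969, p. 299] [cite: VoisinHodgeI2002, §7.1.1] -/
theorem span_rational_ker_restrictCompl_eq_ker (hX : IsSmoothProjective n X) (Z : Set X.left)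
    (k : ℕ) :
    Submodule.span ℂ {x : complexBetti X k |
        IsRationalClass x ∧ complexBetti.restrictCompl X Z k x = 0} =
      LinearMap.ker (complexBetti.restrictCompl X Z k).hom :=
  le_antisymm (Submodule.span_le.2 fun _ hx ↦ LinearMap.mem_ker.2 hx.2)
    (span_isRationalClass_eq_top_of_isSmoothProjective_holds.ker_restrictCompl_le_span hX Z k)

end Kernel

/-! ### The cluster's named facts along Grothendieck's line -/

section Reductions

/-- **`Grothendieck1969_supportedClasses_isSubHodge` along the printed line of p. 300** (PROVED
reduction): from Deligne's description of `Filt'` by Gysin images (`hD`, named fact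
`Deligne1974_ker_restrictCompl_eq_iSup_range_complexGysin`), desingularisations (`hH`, named fact
`Resolution.Hironaka1964_projective`), Hodge structures on the `H˙(Y^an)` (`hM`, named fact
`nonempty_hodgeModel`), THE Hodge decomposition of `H˙(X^an)` (`hI`, named fact
`hodgePQ_independent_of_hodgeModel`), and "the previous homomorphisms are compatible with the
Hodge structures" (`hG`, explicit: the Gysin morphisms `complexGysin μ` have bidegree
`(dim X - dim Y, dim X - dim Y)`, Voisin I §7.3.2 — not a named fact of the tree, D-0026).
Assembly: `…_of_kerRestriction` (`…KernelSubHodge`) with its hypothesis `hK` supplied closed set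
by closed set by `isSubHodge_map_ker_restrictCompl_of_gysin` (`r = 0`), the complexified rational
kernel being the kernel (`span_rational_ker_restrictCompl_eq_ker`).
[cite: GrothendieckTopology1969, p. 300 and footnote †] [cite: DeligneHodgeIII1974, Cor. 8.2.8]
[cite: VoisinHodgeI2002, §7.3.2] -/
theorem Grothendieck1969_supportedClasses_isSubHodge_of_gysin
    (hD : Deligne1974_ker_restrictCompl_eq_iSup_range_complexGysin)
    (hH : Hironaka1964_projective.{0})
    (hM : ∀ (m : ℕ) (Y : SchemeOver ℂ), nonempty_hodgeModel m Y)
    (hI : hodgePQ_independent_of_hodgeModel) (μ : OrientationFamily)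
    (hG : ∀ ⦃m n : ℕ⦄ ⦃Y X : SchemeOver ℂ⦄ (hY : IsSmoothProjective m Y)
      (hX : IsSmoothProjective n X) (g : Y ⟶ X) ⦃a b : ℕ⦄ (hab : a + 2 * n = b + 2 * m)
      ⦃p q p' q' : ℕ⦄, p' + m = p + n → q' + m = q + n → ∀ ⦃y : complexBetti Y a⦄,
        IsOfHodgeType m Y a p q y → IsOfHodgeType n X b p' q' (complexGysin μ hY hX g hab y)) :
    Grothendieck1969_supportedClasses_isSubHodge :=
  Grothendieck1969_supportedClasses_isSubHodge_of_kerRestriction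
    (fun _ _ hX A k Z hZ ↦ by
      rw [span_rational_ker_restrictCompl_eq_ker hX Z k]
      exact (isSubHodge_map_ker_restrictCompl_of_gysin hD hH hM hI μ hG hX A k hZ (r := 0)
        (fun z _ ↦ by simp)).1)
    span_isRationalClass_eq_top_of_isSmoothProjective_holds

/-- **`HodgeTheory.Grothendieck1969_supportedClasses_le_hodgeConiveau` along the same line**
(PROVED reduction; Voisin 2014, Thm. 2.39 (ii): `Nˢ Hᵏ` has Hodge coniveau `≥ s`): the Gysin
image of `Hᵃ(Yⱼ(ℂ))`, `dim Yⱼ ≤ n - s`, lies in `⨆_{p, q ≥ s} H^{p,q}`.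
[cite: GrothendieckTopology1969, pp. 299–300] [cite: VoisinChowRings2014, Def. 2.38 and Thm. 2.39] -/
theorem Grothendieck1969_supportedClasses_le_hodgeConiveau_of_gysin
    (hD : Deligne1974_ker_restrictCompl_eq_iSup_range_complexGysin)
    (hH : Hironaka1964_projective.{0})
    (hM : ∀ (m : ℕ) (Y : SchemeOver ℂ), nonempty_hodgeModel m Y)
    (hI : hodgePQ_independent_of_hodgeModel) (μ : OrientationFamily)
    (hG : ∀ ⦃m n : ℕ⦄ ⦃Y X : SchemeOver ℂ⦄ (hY : IsSmoothProjective m Y)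
      (hX : IsSmoothProjective n X) (g : Y ⟶ X) ⦃a b : ℕ⦄ (hab : a + 2 * n = b + 2 * m)
      ⦃p q p' q' : ℕ⦄, p' + m = p + n → q' + m = q + n → ∀ ⦃y : complexBetti Y a⦄,
        IsOfHodgeType m Y a p q y → IsOfHodgeType n X b p' q' (complexGysin μ hY hX g hab y)) :
    Grothendieck1969_supportedClasses_le_hodgeConiveau :=
  Grothendieck1969_supportedClasses_le_hodgeConiveau_of_kerRestriction
    (fun _ _ hX A k s Z hZ hs ↦ by
      rw [span_rational_ker_restrictCompl_eq_ker hX Z k]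
      exact (isSubHodge_map_ker_restrictCompl_of_gysin hD hH hM hI μ hG hX A k hZ hs).2)
    span_isRationalClass_eq_top_of_isSmoothProjective_holds

/-- **Grothendieck's inclusion (∗) of p. 299, `Filt'ᵖ Hⁱ(X^an, ℚ) ⊂ Filtᵖ Hⁱ(X^an, ℂ)`, along the
same line** ("it is well-known that the second is finer than the first"; PROVED reduction): the
Barriers named fact `Grothendieck1969_supportedClasses_le_hodgeFiltration`, Hodge coniveau `≥ p`
implying `Fᵖ`. [cite: GrothendieckTopology1969, p. 299 (∗)] [cite: VoisinChowRings2014, Thm. 2.39] -/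
theorem Grothendieck1969_supportedClasses_le_hodgeFiltration_of_gysin
    (hD : Deligne1974_ker_restrictCompl_eq_iSup_range_complexGysin)
    (hH : Hironaka1964_projective.{0})
    (hM : ∀ (m : ℕ) (Y : SchemeOver ℂ), nonempty_hodgeModel m Y)
    (hI : hodgePQ_independent_of_hodgeModel) (μ : OrientationFamily)
    (hG : ∀ ⦃m n : ℕ⦄ ⦃Y X : SchemeOver ℂ⦄ (hY : IsSmoothProjective m Y)
      (hX : IsSmoothProjective n X) (g : Y ⟶ X) ⦃a b : ℕ⦄ (hab : a + 2 * n = b + 2 * m)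
      ⦃p q p' q' : ℕ⦄, p' + m = p + n → q' + m = q + n → ∀ ⦃y : complexBetti Y a⦄,
        IsOfHodgeType m Y a p q y → IsOfHodgeType n X b p' q' (complexGysin μ hY hX g hab y)) :
    Grothendieck1969_supportedClasses_le_hodgeFiltration :=
  (Grothendieck1969_supportedClasses_le_hodgeConiveau_of_gysin hD hH hM hI μ
    hG).supportedClasses_le_hodgeFiltration

/-- **The even rank of `Filt'ᵖ Hⁱ(X, ℚ)`, `i` odd, along the same line** (PROVED reduction; the
parity step "If `i` is odd, this would imply for instance that the dimension over `ℚ` of that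
space is even" is proved in `…Parity`, in a real Hodge model, `hR`).
[cite: GrothendieckTopology1969, p. 300] -/
theorem Grothendieck1969_rationalSupportedClasses_evenRank_of_gysin
    (hD : Deligne1974_ker_restrictCompl_eq_iSup_range_complexGysin)
    (hH : Hironaka1964_projective.{0})
    (hM : ∀ (m : ℕ) (Y : SchemeOver ℂ), nonempty_hodgeModel m Y)
    (hI : hodgePQ_independent_of_hodgeModel) (μ : OrientationFamily)
    (hG : ∀ ⦃m n : ℕ⦄ ⦃Y X : SchemeOver ℂ⦄ (hY : IsSmoothProjective m Y)
      (hX : IsSmoothProjective n X) (g : Y ⟶ X) ⦃a b : ℕ⦄ (hab : a + 2 * n = b + 2 * m)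
      ⦃p q p' q' : ℕ⦄, p' + m = p + n → q' + m = q + n → ∀ ⦃y : complexBetti Y a⦄,
        IsOfHodgeType m Y a p q y → IsOfHodgeType n X b p' q' (complexGysin μ hY hX g hab y))
    (hR : exists_isReal_hodgeModel) :
    Grothendieck1969_rationalSupportedClasses_evenRank :=
  Grothendieck1969_rationalSupportedClasses_evenRank_of_isSubHodge_of_exists_isReal
    (Grothendieck1969_supportedClasses_isSubHodge_of_gysin hD hH hM hI μ hG) hR

/-- **The barrier `Grothendieck1969_generalHodgeConjecture_false` along Grothendieck's own line**
(PROVED reduction): both Hodge-theoretic inputs of pp. 299–300 — the sub-Hodge property of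
`Filt' ⊗ ℂ` and the inclusion (∗), here in coniveau form — come from the Gysin description
(`hD`, `hH`, `hM`, `hI`, `hG`); the remaining input is the Hodge structure of `H³(E_τ³)` in the
Künneth basis (`hE`, named fact `Grothendieck1969_ellipticCurveCubed_hodgeDecomposition`, from
which the odd rank of `Filt'¹ H³(E_τ³, ℚ)` for `τ` cubic and the parity step in a model of `E_τ³`
are proved in `…FiltOne` / `…TorusSymmetryProofs`).
[cite: GrothendieckTopology1969, pp. 299–300] [cite: DeligneHodgeIII1974, Cor. 8.2.8] -/
theorem Grothendieck1969_generalHodgeConjecture_false_of_gysin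
    (hD : Deligne1974_ker_restrictCompl_eq_iSup_range_complexGysin)
    (hH : Hironaka1964_projective.{0})
    (hM : ∀ (m : ℕ) (Y : SchemeOver ℂ), nonempty_hodgeModel m Y)
    (hI : hodgePQ_independent_of_hodgeModel) (μ : OrientationFamily)
    (hG : ∀ ⦃m n : ℕ⦄ ⦃Y X : SchemeOver ℂ⦄ (hY : IsSmoothProjective m Y)
      (hX : IsSmoothProjective n X) (g : Y ⟶ X) ⦃a b : ℕ⦄ (hab : a + 2 * n = b + 2 * m)
      ⦃p q p' q' : ℕ⦄, p' + m = p + n → q' + m = q + n → ∀ ⦃y : complexBetti Y a⦄,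
        IsOfHodgeType m Y a p q y → IsOfHodgeType n X b p' q' (complexGysin μ hY hX g hab y))
    (hE : Grothendieck1969_ellipticCurveCubed_hodgeDecomposition) :
    Grothendieck1969_generalHodgeConjecture_false :=
  Grothendieck1969_generalHodgeConjecture_false_of_hodgeDecomposition_of_hodgeConiveau hE
    (Grothendieck1969_supportedClasses_isSubHodge_of_gysin hD hH hM hI μ hG)
    (Grothendieck1969_supportedClasses_le_hodgeConiveau_of_gysin hD hH hM hI μ hG)

end Reductions

end HodgeConjecture
end Barriers

end Literature.Barriers.HodgeConjecture

end
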